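import Mathlib
import Summits.PneNP.PneNP.Theses.AeaCutRectangles

/-!
# FoolingMeasure (stmt-PneNP-19727) — round-2 crux ideas, seat 1, gen 8 (`IdeasR2g8`)

First lemmas / typed targets for the three g8 idea cards.  All three live in the NORMAL CYCLE
SYSTEM universe (seat 2, `Cruxes/FoolingMeasure/NormalCycleSystems.lean`; the minimal mirror of
`SeamShieldCompletionEntropy.lean` is re-declared so that this file is self-contained).

* `heavy-union-pruning` — PROVED (abstract): `sum_prune_le`, `sum_prune_eq`, `rect_mass_after_pruning`
  (delete the union of all heavy rectangles; every rectangle of the family becomes light; renormalise), and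
  PROVED (the reduction itself): `pruningPrinciple_holds : PruningPrinciple t`, i.e.
  `HeavyUnionLight t → FoolingMeasure` — the crux has a certified sufficient condition about ONE explicit measure
  (uniform on rigid normal `t`-systems minus the heavy members, pushed forward to edge sets; `∃ᶠ n` met along
  the infinitely many good `n = 3q+1`; heavy rectangles get mass 0, light ones `≤ 2·delta n (C+1) ≤ delta n C`).
  TYPED (the open content): `HeavyMember`, `HeavyUnionLight`.
* `free-rate-transfer` — PROVED (bookkeeping): `fibre_le_free_of_transfer`.
  TYPED: `firstMoment`, `AbundanceAt`, `plantedCount`, `freeProb`, `PlantedUpperBound`,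
  `FreeSparseRate`, `MeasureHalfDensity`.
* `seam-scc-cayley` — PROVED: `upset_separates_iff_not_biReachable` (abstract 2-SAT core: one xor clause over an
  implication digraph is satisfiable iff its ends are not mutually reachable) and `frameUpsetCriterion_holds :
  FrameUpsetCriterion q t` (the clause table: frame-`k` shift colourings of an edge set = up-sets of `frameArc`
  splitting the equal-residue edges) and `blockedCayley_holds : BlockedCayley q t` (at a cell-union cut the
  blocking relation between cell-preserving relabellings depends only on `ψ₁⁻¹ψ₂` — the Cayley structure, via
  `edges_relabel`, `alicePart_relabel`, `bobPart_relabel`, `colorable_image_iff`).  TYPED (targets):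
  `CellCayleyCliqueBound` (Q, rank 2 of the card), `Blocked`, `relabel`, `CellPreserving`, `CellUnion`.

FRONTIER restricted-model rung (AEA / cut rectangles); nothing here moves `P ≠ NP`.
-/

set_option linter.dupNamespace false
set_option linter.unusedVariables false

namespace Summit.PneNP.PneNP.Cruxes.FoolingMeasure.IdeasR2g8

open Finset

/-! ## 0. Normal cycle systems (minimal mirror) -/

/-- `t` rulers on `n = 3q+1` vertices: `P k v` is the position of vertex `v` along ruler `k`. -/
abbrev Rulers (q t : ℕ) := Fin t → Equiv.Perm (Fin (3 * q + 1))

variable {q t : ℕ}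

/-- successor of `v` along ruler `k`. -/
def succ (P : Rulers q t) (k : Fin t) (v : Fin (3 * q + 1)) : Fin (3 * q + 1) :=
  (P k).symm (P k v + 1)

/-- NORMALITY: every edge of cycle `k`, read along any other ruler `i`, jumps forward by `≡ 2 (mod 3)`. -/
def IsNormal (P : Rulers q t) : Prop :=
  ∀ i k : Fin t, i ≠ k → ∀ v, ((P i (succ P k v) - P i v).val) % 3 = 2

/-- the edge set: union of the `t` Hamiltonian cycles. -/
def edges (P : Rulers q t) : Finset (Sym2 (Fin (3 * q + 1))) :=
  univ.biUnion fun k => univ.image fun v => s(v, succ P k v)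

/-- rigid = the union of the cycles is not properly 3-colourable. -/
def Rigid (P : Rulers q t) : Prop :=
  ¬ (SimpleGraph.fromEdgeSet ((edges P : Finset _) : Set (Sym2 (Fin (3 * q + 1))))).Colorable 3

open Classical in
/-- number of (labelled) normal systems. -/
noncomputable def normalCount (q t : ℕ) : ℕ :=
  (univ.filter fun P : Rulers q t => IsNormal P).card

open Classical in
/-- the rigid normal systems (the support of the measure `μ_t` after conditioning on rigidity). -/
noncomputable def rigidNormal (q t : ℕ) : Finset (Rulers q t) :=
  univ.filter fun P : Rulers q t => IsNormal P ∧ Rigid P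

/-- Bob's part of a system at the cut `B`: the edges inside `B`. -/
def bobPart (P : Rulers q t) (B : Finset (Fin (3 * q + 1))) : Finset (Sym2 (Fin (3 * q + 1))) :=
  (edges P).filter fun e => ∀ v ∈ e, v ∈ B

/-- Alice's part of a system at the cut `B`: the edges meeting `A = Bᶜ`. -/
def alicePart (P : Rulers q t) (B : Finset (Fin (3 * q + 1))) : Finset (Sym2 (Fin (3 * q + 1))) :=
  (edges P).filter fun e => ∃ v ∈ e, v ∉ B

/-! ## 1. Card `heavy-union-pruning` -/

section pruning

variable {ι : Type*} [DecidableEq ι]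

/-- the HEAVY UNION: all points lying in some rectangle of the family `𝓡` of `μ`-weight `> δ`. -/
noncomputable def heavyUnion (μ : ι → ℝ) (𝓡 : Finset (Finset ι)) (δ : ℝ) : Finset ι :=
  (𝓡.filter fun R => δ < ∑ i ∈ R, μ i).biUnion id

/-- pruned weights: `μ` set to zero on the heavy union. -/
noncomputable def prune (μ : ι → ℝ) (𝓡 : Finset (Finset ι)) (δ : ℝ) : ι → ℝ :=
  fun i => if i ∈ heavyUnion μ 𝓡 δ then 0 else μ i

theorem mem_heavyUnion {μ : ι → ℝ} {𝓡 : Finset (Finset ι)} {δ : ℝ} {R : Finset ι} {i : ι}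
    (hR : R ∈ 𝓡) (hheavy : δ < ∑ j ∈ R, μ j) (hi : i ∈ R) : i ∈ heavyUnion μ 𝓡 δ := by
  unfold heavyUnion
  rw [Finset.mem_biUnion]
  exact ⟨R, Finset.mem_filter.mpr ⟨hR, hheavy⟩, hi⟩

theorem prune_nonneg {μ : ι → ℝ} (hμ : ∀ i, 0 ≤ μ i) (𝓡 : Finset (Finset ι)) (δ : ℝ) (i : ι) :
    0 ≤ prune μ 𝓡 δ i := by
  unfold prune; split_ifs <;> simp [hμ i]

theorem prune_le_self {μ : ι → ℝ} (hμ : ∀ i, 0 ≤ μ i) (𝓡 : Finset (Finset ι)) (δ : ℝ) (i : ι) :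
    prune μ 𝓡 δ i ≤ μ i := by
  unfold prune; split_ifs <;> simp [hμ i]

theorem prune_eq_zero_of_mem {μ : ι → ℝ} {𝓡 : Finset (Finset ι)} {δ : ℝ} {i : ι}
    (hi : i ∈ heavyUnion μ 𝓡 δ) : prune μ 𝓡 δ i = 0 := by
  unfold prune; simp [hi]

theorem prune_eq_self_of_not_mem {μ : ι → ℝ} {𝓡 : Finset (Finset ι)} {δ : ℝ} {i : ι}
    (hi : i ∉ heavyUnion μ 𝓡 δ) : prune μ 𝓡 δ i = μ i := by
  unfold prune; simp [hi]

/-- KEY LEMMA (one round of pruning suffices): after deleting the heavy union, EVERY rectangle of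
the family has pruned weight `≤ δ` — a heavy one because all its points were deleted, a light one
because pruning only decreases weights. -/
theorem sum_prune_le {μ : ι → ℝ} (hμ : ∀ i, 0 ≤ μ i) (𝓡 : Finset (Finset ι)) {δ : ℝ}
    (hδ : 0 ≤ δ) {R : Finset ι} (hR : R ∈ 𝓡) : ∑ i ∈ R, prune μ 𝓡 δ i ≤ δ := by
  by_cases h : δ < ∑ j ∈ R, μ j
  · have hz : ∀ i ∈ R, prune μ 𝓡 δ i = 0 := fun i hi =>
      prune_eq_zero_of_mem (mem_heavyUnion hR h hi)
    rw [Finset.sum_eq_zero hz]; exact hδ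
  · exact le_trans (Finset.sum_le_sum fun i _ => prune_le_self hμ 𝓡 δ i) (not_lt.mp h)

/-- the pruned total mass is the original mass minus the mass of the heavy union. -/
theorem sum_prune_eq [Fintype ι] (μ : ι → ℝ) (𝓡 : Finset (Finset ι)) (δ : ℝ) :
    ∑ i, prune μ 𝓡 δ i = ∑ i, μ i - ∑ i ∈ heavyUnion μ 𝓡 δ, μ i := by
  classical
  have hsplit := (Finset.sum_filter_add_sum_filter_not (s := (univ : Finset ι))
    (p := fun i => i ∈ heavyUnion μ 𝓡 δ) (f := fun i => prune μ 𝓡 δ i))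
  have hsplit' := (Finset.sum_filter_add_sum_filter_not (s := (univ : Finset ι))
    (p := fun i => i ∈ heavyUnion μ 𝓡 δ) (f := fun i => μ i))
  have h1 : ∑ i ∈ univ.filter (fun i => i ∈ heavyUnion μ 𝓡 δ), prune μ 𝓡 δ i = 0 :=
    Finset.sum_eq_zero fun i hi => prune_eq_zero_of_mem (Finset.mem_filter.mp hi).2
  have h2 : ∑ i ∈ univ.filter (fun i => ¬ i ∈ heavyUnion μ 𝓡 δ), prune μ 𝓡 δ i
      = ∑ i ∈ univ.filter (fun i => ¬ i ∈ heavyUnion μ 𝓡 δ), μ i :=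
    Finset.sum_congr rfl fun i hi => prune_eq_self_of_not_mem (Finset.mem_filter.mp hi).2
  have h3 : univ.filter (fun i => i ∈ heavyUnion μ 𝓡 δ) = heavyUnion μ 𝓡 δ := by
    ext i; simp
  rw [h3] at hsplit'
  rw [← hsplit, h1, h2, zero_add]
  linarith

/-- PRUNING PRINCIPLE, abstract form.  If the heavy union carries at most half of a probability
vector `μ`, the renormalised pruned vector gives EVERY rectangle of the family weight `≤ 2δ`. -/
theorem rect_mass_after_pruning [Fintype ι] {μ : ι → ℝ} (hμ : ∀ i, 0 ≤ μ i) (hμ1 : ∑ i, μ i = 1)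
    (𝓡 : Finset (Finset ι)) {δ : ℝ} (hδ : 0 ≤ δ)
    (hhalf : ∑ i ∈ heavyUnion μ 𝓡 δ, μ i ≤ 1 / 2) {R : Finset ι} (hR : R ∈ 𝓡) :
    (∑ i ∈ R, prune μ 𝓡 δ i) / (∑ i, prune μ 𝓡 δ i) ≤ 2 * δ := by
  have hmass : (1 : ℝ) / 2 ≤ ∑ i, prune μ 𝓡 δ i := by
    rw [sum_prune_eq, hμ1]; linarith
  have hpos : (0 : ℝ) < ∑ i, prune μ 𝓡 δ i := by linarith
  rw [div_le_iff₀ hpos]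
  calc ∑ i ∈ R, prune μ 𝓡 δ i ≤ δ := sum_prune_le hμ 𝓡 hδ hR
    _ = 2 * δ * (1 / 2) := by ring
    _ ≤ 2 * δ * ∑ i, prune μ 𝓡 δ i := by
        apply mul_le_mul_of_nonneg_left hmass; linarith

end pruning

/-- the target weight scale of X1 with constant `C` at `n` vertices: `2^{-(n/2)·log₂ n - C·n}`. -/
noncomputable def delta (n : ℕ) (C : ℝ) : ℝ :=
  (2 : ℝ) ^ (-((n : ℝ) / 2 * Real.logb 2 n) - C * n)

open Classical in
/-- the MEMBER SET of the cut rectangle `(B, 𝓐, 𝓑)` inside the rigid normal systems. -/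
noncomputable def memberSet (q t : ℕ) (B : Finset (Fin (3 * q + 1)))
    (𝓐 𝓑 : Finset (Finset (Sym2 (Fin (3 * q + 1))))) : Finset (Rulers q t) :=
  (rigidNormal q t).filter fun P => alicePart P B ∈ 𝓐 ∧ bobPart P B ∈ 𝓑

/-- a VALID cut rectangle: every cross union is non-3-colourable. -/
def ValidRect {n : ℕ} (𝓐 𝓑 : Finset (Finset (Sym2 (Fin n)))) : Prop :=
  ∀ α ∈ 𝓐, ∀ β ∈ 𝓑,
    ¬ (SimpleGraph.fromEdgeSet ((α ∪ β : Finset (Sym2 (Fin n))) : Set (Sym2 (Fin n)))).Colorable 3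

open Classical in
/-- `P` is a HEAVY MEMBER at scale `(ε, C)`: it lies in some valid rectangle at some `ε`-balanced cut
whose member set has more than a `delta n C` fraction of the rigid normal systems. -/
def HeavyMember (q t : ℕ) (ε C : ℝ) (P : Rulers q t) : Prop :=
  ∃ (B : Finset (Fin (3 * q + 1))) (𝓐 𝓑 : Finset (Finset (Sym2 (Fin (3 * q + 1))))),
    (1 / 2 - ε) * (3 * q + 1 : ℝ) ≤ B.card ∧ (B.card : ℝ) ≤ (1 / 2 + ε) * (3 * q + 1 : ℝ) ∧
    ValidRect 𝓐 𝓑 ∧ P ∈ memberSet q t B 𝓐 𝓑 ∧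
    delta (3 * q + 1) C * ((rigidNormal q t).card : ℝ) < ((memberSet q t B 𝓐 𝓑).card : ℝ)

open Classical in
/-- TYPED TARGET of the card (the measure-side statement that replaces (Q) for the UNPRUNED `μ_t`):
for some `ε` and every `C`, for INFINITELY MANY `q` (only `∃ᶠ n` is needed downstream, and rigid normal
systems need not exist for every `n ≡ 1 (mod 3)`), the heavy members at scale `(ε, C+1)` are at most HALF
of the rigid normal `t`-systems and there is at least one rigid normal system. -/
def HeavyUnionLight (t : ℕ) : Prop :=
  ∃ ε : ℝ, 0 < ε ∧ ε ≤ 1 / 4 ∧ ∀ C : ℕ, ∀ N : ℕ, ∃ q ≥ N,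
    0 < (rigidNormal q t).card ∧
    2 * ((rigidNormal q t).filter fun P => HeavyMember q t ε ((C : ℝ) + 1) P).card
      ≤ (rigidNormal q t).card

/-- PRUNING PRINCIPLE (first lemma of the line, to be proved from `rect_mass_after_pruning` by pushing
the pruned uniform measure on rigid normal systems forward to edge sets): light heavy-union at scale
`C+1` gives a fooling measure at scale `C` (`2·delta n (C+1) ≤ delta n C`). -/
def PruningPrinciple (t : ℕ) : Prop :=
  HeavyUnionLight t → Summit.PneNP.PneNP.Theses.AeaCutRectangles.FoolingMeasure


/-! ### Proof of `PruningPrinciple` (push the pruned uniform measure forward to edge sets) -/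

section pruningPrinciple

theorem succ_ne_self (hq : 1 ≤ q) (P : Rulers q t) (k : Fin t) (v : Fin (3 * q + 1)) :
    succ P k v ≠ v := by
  intro h
  unfold succ at h
  have h2 : P k v + 1 = P k v := by
    have := congrArg (P k) h
    simpa using this
  have h3 : (1 : Fin (3 * q + 1)) = 0 := by
    have h4 : P k v + 1 = P k v + 0 := by rw [add_zero]; exact h2
    exact add_left_cancel h4
  rw [Fin.one_eq_zero_iff] at h3
  omega

theorem edges_not_isDiag (hq : 1 ≤ q) (P : Rulers q t) : ∀ e ∈ edges P, ¬ e.IsDiag := by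
  intro e he
  simp only [edges, Finset.mem_biUnion, Finset.mem_univ, true_and, Finset.mem_image] at he
  obtain ⟨k, v, rfl⟩ := he
  rw [Sym2.mk_isDiag_iff]
  exact (succ_ne_self hq P k v).symm

theorem parts_of_edges_eq_union (P : Rulers q t) (B : Finset (Fin (3 * q + 1)))
    {α β : Finset (Sym2 (Fin (3 * q + 1)))}
    (hα : ∀ e ∈ α, ¬ e.IsDiag ∧ ∃ v ∈ e, v ∉ B) (hβ : ∀ e ∈ β, ¬ e.IsDiag ∧ ∀ v ∈ e, v ∈ B)
    (h : edges P = α ∪ β) : alicePart P B = α ∧ bobPart P B = β := by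
  constructor
  · ext e
    simp only [alicePart, Finset.mem_filter, h, Finset.mem_union]
    constructor
    · rintro ⟨he | he, v, hv, hvB⟩
      · exact he
      · exact absurd ((hβ e he).2 v hv) hvB
    · intro he
      exact ⟨Or.inl he, (hα e he).2⟩
  · ext e
    simp only [bobPart, Finset.mem_filter, h, Finset.mem_union]
    constructor
    · rintro ⟨he | he, hall⟩
      · obtain ⟨v, hv, hvB⟩ := (hα e he).2
        exact absurd (hall v hv) hvB
      · exact he
    · intro he
      exact ⟨Or.inr he, (hβ e he).2⟩

theorem delta_nonneg (n : ℕ) (C : ℝ) : 0 ≤ delta n C := by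
  unfold delta; positivity

theorem two_mul_delta_succ_le (n : ℕ) (hn : 1 ≤ n) (C : ℝ) :
    2 * delta n (C + 1) ≤ delta n C := by
  unfold delta
  have hn' : (1 : ℝ) ≤ n := by exact_mod_cast hn
  calc 2 * (2 : ℝ) ^ (-((n : ℝ) / 2 * Real.logb 2 n) - (C + 1) * n)
      = (2 : ℝ) ^ (-((n : ℝ) / 2 * Real.logb 2 n) - (C + 1) * n + 1) := by
        rw [Real.rpow_add (by norm_num : (0 : ℝ) < 2), Real.rpow_one]; ring
    _ ≤ (2 : ℝ) ^ (-((n : ℝ) / 2 * Real.logb 2 n) - C * n) := by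
        apply Real.rpow_le_rpow_of_exponent_le (by norm_num : (1 : ℝ) ≤ 2)
        nlinarith

open Classical in
/-- THE PRUNING PRINCIPLE HOLDS: `HeavyUnionLight t → FoolingMeasure`. -/
theorem pruningPrinciple_holds (t : ℕ) : PruningPrinciple t := by
  rintro ⟨ε, hε, hε4, hC⟩
  refine ⟨ε, hε, hε4, fun C => ?_⟩
  rw [Filter.frequently_atTop]
  intro N
  obtain ⟨m, hmN, hpos, hheavy⟩ := hC C (max N 1)
  have hNm : N ≤ m := le_trans (le_max_left _ _) hmN
  have h1m : 1 ≤ m := le_trans (le_max_right _ _) hmN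
  refine ⟨3 * m + 1, by omega, ?_⟩
  set RN := rigidNormal m t with hRN
  set L := RN.filter fun P => ¬ HeavyMember m t ε ((C : ℝ) + 1) P with hL
  have hcardRL : (RN.filter fun P => HeavyMember m t ε ((C : ℝ) + 1) P).card + L.card = RN.card := by
    rw [hL]; exact Finset.card_filter_add_card_filter_not _
  have hLpos : 0 < L.card := by omega
  have hRN2L : RN.card ≤ 2 * L.card := by omega
  have hLposR : (0 : ℝ) < L.card := by exact_mod_cast hLpos
  refine ⟨fun S => ((L.filter fun P => edges P = S).card : ℝ) / L.card, ?_, ?_, ?_, ?_⟩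
  · intro S; positivity
  · rw [← Finset.sum_div, div_eq_one_iff_eq hLposR.ne', ← Nat.cast_sum, Nat.cast_inj]
    exact (Finset.card_eq_sum_card_fiberwise (fun P _ => Finset.mem_univ (edges P))).symm
  · intro S hS
    have hne : (L.filter fun P => edges P = S).Nonempty := by
      rw [Finset.nonempty_iff_ne_empty]
      intro h0
      apply hS
      simp only [h0, Finset.card_empty, Nat.cast_zero, zero_div]
    obtain ⟨P, hP⟩ := hne
    rw [Finset.mem_filter] at hP
    obtain ⟨hPL, rfl⟩ := hP
    have hPRN : P ∈ RN := (Finset.mem_filter.mp hPL).1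
    have hrig : Rigid P := by
      rw [hRN, rigidNormal, Finset.mem_filter] at hPRN; exact hPRN.2.2
    exact ⟨edges_not_isDiag h1m P, hrig⟩
  · intro B hB1 hB2 𝓐 𝓑 h𝓐 h𝓑 hvalid
    set M := L.filter fun P => alicePart P B ∈ 𝓐 ∧ bobPart P B ∈ 𝓑 with hM
    have hfib : ∑ p ∈ 𝓐 ×ˢ 𝓑, ((L.filter fun P => edges P = p.1 ∪ p.2).card : ℝ) ≤ M.card := by
      have hMsum : M.card =
          ∑ p ∈ 𝓐 ×ˢ 𝓑, (M.filter fun P => (alicePart P B, bobPart P B) = p).card := by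
        apply Finset.card_eq_sum_card_fiberwise
        intro P hP
        have hP' : P ∈ M := by exact_mod_cast hP
        rw [hM, Finset.mem_filter] at hP'
        show (alicePart P B, bobPart P B) ∈ ((𝓐 ×ˢ 𝓑 : Finset _) : Set _)
        rw [Finset.mem_coe]
        exact Finset.mem_product.mpr hP'.2
      rw [hMsum, Nat.cast_sum]
      apply Finset.sum_le_sum
      intro p hp
      rw [Nat.cast_le]
      apply Finset.card_le_card
      intro P hP
      obtain ⟨hPL, hedges⟩ := Finset.mem_filter.mp hP
      obtain ⟨hp1, hp2⟩ := Finset.mem_product.mp hp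
      obtain ⟨ha, hb⟩ := parts_of_edges_eq_union P B (h𝓐 p.1 hp1) (h𝓑 p.2 hp2) hedges
      refine Finset.mem_filter.mpr ⟨?_, ?_⟩
      · rw [hM]
        refine Finset.mem_filter.mpr ⟨hPL, ?_, ?_⟩
        · rw [ha]; exact hp1
        · rw [hb]; exact hp2
      · rw [ha, hb]
    have hMmem : M ⊆ memberSet m t B 𝓐 𝓑 := by
      intro P hP
      rw [hM, Finset.mem_filter] at hP
      rw [memberSet, Finset.mem_filter]
      exact ⟨(Finset.mem_filter.mp hP.1).1, hP.2⟩
    have hMle : (M.card : ℝ) ≤ 2 * delta (3 * m + 1) ((C : ℝ) + 1) * L.card := by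
      by_cases hheavyR : delta (3 * m + 1) ((C : ℝ) + 1) * (RN.card : ℝ)
          < ((memberSet m t B 𝓐 𝓑).card : ℝ)
      · have hM0 : M = ∅ := by
          rw [Finset.eq_empty_iff_forall_notMem]
          intro P hP
          have hPmem := hMmem hP
          rw [hM, Finset.mem_filter] at hP
          have hPL := hP.1
          rw [hL, Finset.mem_filter] at hPL
          apply hPL.2
          refine ⟨B, 𝓐, 𝓑, ?_, ?_, hvalid, hPmem, hheavyR⟩
          · push_cast at hB1 ⊢; linarith
          · push_cast at hB2 ⊢; linarith
        rw [hM0, Finset.card_empty, Nat.cast_zero]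
        have := delta_nonneg (3 * m + 1) ((C : ℝ) + 1)
        positivity
      · push Not at hheavyR
        calc (M.card : ℝ) ≤ (memberSet m t B 𝓐 𝓑).card := by
              exact_mod_cast Finset.card_le_card hMmem
          _ ≤ delta (3 * m + 1) ((C : ℝ) + 1) * RN.card := hheavyR
          _ ≤ delta (3 * m + 1) ((C : ℝ) + 1) * ((2 * L.card : ℕ) : ℝ) := by
              apply mul_le_mul_of_nonneg_left _ (delta_nonneg _ _)
              exact_mod_cast hRN2L
          _ = 2 * delta (3 * m + 1) ((C : ℝ) + 1) * L.card := by push_cast; ring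
    have hexp := two_mul_delta_succ_le (3 * m + 1) (by omega) (C : ℝ)
    show ∑ p ∈ 𝓐 ×ˢ 𝓑, ((L.filter fun P => edges P = p.1 ∪ p.2).card : ℝ) / L.card
        ≤ delta (3 * m + 1) (C : ℝ)
    rw [← Finset.sum_div, div_le_iff₀ hLposR]
    calc ∑ p ∈ 𝓐 ×ˢ 𝓑, ((L.filter fun P => edges P = p.1 ∪ p.2).card : ℝ)
        ≤ M.card := hfib
      _ ≤ 2 * delta (3 * m + 1) ((C : ℝ) + 1) * L.card := hMle
      _ ≤ delta (3 * m + 1) (C : ℝ) * L.card := by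
          apply mul_le_mul_of_nonneg_right hexp hLposR.le

end pruningPrinciple

/-! ## 2. Card `free-rate-transfer` -/

/-- the labelled first-moment count of normal `t`-systems: `(n!)^t · 3^{-t(t-1)·n}`, `n = 3q+1`. -/
noncomputable def firstMoment (q t : ℕ) : ℝ :=
  ((Nat.factorial (3 * q + 1) : ℝ) ^ t) / (3 : ℝ) ^ (t * (t - 1) * (3 * q + 1))

/-- ABUNDANCE at exponential defect `K`: `normalCount ≥ firstMoment · 2^{-K n}` for INFINITELY MANY `q`
(the cell's (E1) in the form the route needs — only `∃ᶠ n` is used downstream, and an `∀ q ≥ q₀` form would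
be false for trivial reasons at any `n` without normal systems; numerically `K ≈ 0` for `t = 2`, NORMAL-CENSUS-g5s1). -/
def AbundanceAt (K : ℝ) (t : ℕ) : Prop :=
  ∀ N : ℕ, ∃ q ≥ N, firstMoment q t ≤ (2 : ℝ) ^ (K * (3 * q + 1 : ℝ)) * (normalCount q t : ℝ)

open Classical in
/-- PLANTED COUNT: normal systems whose Bob part at `B` is exactly `β`. -/
noncomputable def plantedCount (q t : ℕ) (B : Finset (Fin (3 * q + 1)))
    (β : Finset (Sym2 (Fin (3 * q + 1)))) : ℕ :=
  (univ.filter fun P : Rulers q t => IsNormal P ∧ bobPart P B = β).card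

open Classical in
/-- FREE PROBABILITY of the Bob pattern `β` at `B`: `t` independent uniform rulers, no normality. -/
noncomputable def freeProb (q t : ℕ) (B : Finset (Fin (3 * q + 1)))
    (β : Finset (Sym2 (Fin (3 * q + 1)))) : ℝ :=
  ((univ.filter fun P : Rulers q t => bobPart P B = β).card : ℝ)
    / ((Nat.factorial (3 * q + 1) : ℝ) ^ t)

/-- PLANTED UPPER BOUND (the provable direction of the transfer; crux of the card): planting a Bob
pattern costs, among NORMAL systems, at most `2^{K' n}` times what it costs in the free model times the
first moment — an entropy / second-moment UPPER bound, no lower-tail control of normality needed. -/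
def PlantedUpperBound (K' : ℝ) (t : ℕ) : Prop :=
  ∃ q₀ : ℕ, ∀ q ≥ q₀, ∀ (B : Finset (Fin (3 * q + 1))) (β : Finset (Sym2 (Fin (3 * q + 1)))),
    (plantedCount q t B β : ℝ) ≤ (2 : ℝ) ^ (K' * (3 * q + 1 : ℝ)) * firstMoment q t * freeProb q t B β

/-- TRANSFER (bookkeeping, proved): abundance at defect `K` and the planted upper bound at `K'`
bound every Bob fibre of `μ_t` by `2^{(K+K') n}` times its FREE probability. -/
theorem fibre_le_free_of_transfer {K K' : ℝ} {t : ℕ} (hA : AbundanceAt K t)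
    (hU : PlantedUpperBound K' t) :
    ∀ N : ℕ, ∃ q ≥ N, 0 < normalCount q t ∧
      ∀ (B : Finset (Fin (3 * q + 1))) (β : Finset (Sym2 (Fin (3 * q + 1)))),
      (plantedCount q t B β : ℝ) / (normalCount q t : ℝ)
        ≤ (2 : ℝ) ^ ((K + K') * (3 * q + 1 : ℝ)) * freeProb q t B β := by
  intro N
  obtain ⟨q₂, h₂⟩ := hU
  obtain ⟨q, hq, hA'⟩ := hA (max N q₂)
  have hqN : q ≥ N := le_trans (le_max_left _ _) hq
  have hq₂ : q ≥ q₂ := le_trans (le_max_right _ _) hq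
  have hFM : 0 < firstMoment q t := by unfold firstMoment; positivity
  have hNpos : (0 : ℝ) < (normalCount q t : ℝ) := by
    by_contra h
    push Not at h
    have h0 : (normalCount q t : ℝ) = 0 := le_antisymm h (Nat.cast_nonneg _)
    rw [h0, mul_zero] at hA'
    exact absurd hA' (not_le.mpr hFM)
  refine ⟨q, hqN, by exact_mod_cast hNpos, fun B β => ?_⟩
  have hU' := h₂ q hq₂ B β
  have hfree : 0 ≤ freeProb q t B β := by
    unfold freeProb; positivity
  have h2K' : (0 : ℝ) < (2 : ℝ) ^ (K' * (3 * q + 1 : ℝ)) := by positivity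
  rw [div_le_iff₀ hNpos]
  calc (plantedCount q t B β : ℝ)
      ≤ (2 : ℝ) ^ (K' * (3 * q + 1 : ℝ)) * firstMoment q t * freeProb q t B β := hU'
    _ ≤ (2 : ℝ) ^ (K' * (3 * q + 1 : ℝ)) * ((2 : ℝ) ^ (K * (3 * q + 1 : ℝ)) * (normalCount q t : ℝ))
          * freeProb q t B β := by
        apply mul_le_mul_of_nonneg_right _ hfree
        exact mul_le_mul_of_nonneg_left hA' h2K'.le
    _ = (2 : ℝ) ^ ((K + K') * (3 * q + 1 : ℝ)) * freeProb q t B β * (normalCount q t : ℝ) := by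
        rw [show (K + K') * (3 * q + 1 : ℝ) = K * (3 * q + 1 : ℝ) + K' * (3 * q + 1 : ℝ) by ring,
          Real.rpow_add (by norm_num : (0 : ℝ) < 2)]
        ring

open Classical in
/-- FREE SPARSE-HALF RATE `c` (a provable large-deviation statement about `t` INDEPENDENT uniform
cyclic orders; per ruler `e_B = |B| - #runs`, rate `c_t^{(1)} = t·(1 - H((1+2ε)/t))`, e.g. `2.10`
at `t = 6`, `ε → 0`): an `ε`-balanced `B` is a sparse half with free probability `≤ 2^{-c n}`. -/
def FreeSparseRate (c ε : ℝ) (t : ℕ) : Prop :=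
  ∃ q₀ : ℕ, ∀ q ≥ q₀, ∀ B : Finset (Fin (3 * q + 1)),
    (1 / 2 - ε) * (3 * q + 1 : ℝ) ≤ B.card →
    ((univ.filter fun P : Rulers q t => 2 * (bobPart P B).card ≤ 3 * q + 1).card : ℝ)
      ≤ (2 : ℝ) ^ (-(c * (3 * q + 1 : ℝ))) * ((Nat.factorial (3 * q + 1) : ℝ) ^ t)

open Classical in
/-- (E2) IN MEASURE (what the route needs after p570033): the `μ_t`-mass of normal systems having
SOME `ε`-balanced sparse half is `≤ 2^{-C n}`; by `fibre_le_free_of_transfer` and a union bound over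
the `≤ 2^n` cuts it follows from `AbundanceAt K`, `PlantedUpperBound K'`, `FreeSparseRate c ε` as soon
as `c > 1 + K + K' + C`. -/
def MeasureHalfDensity (ε C : ℝ) (t : ℕ) : Prop :=
  ∃ q₀ : ℕ, ∀ q ≥ q₀,
    ((univ.filter fun P : Rulers q t => IsNormal P ∧ ∃ B : Finset (Fin (3 * q + 1)),
        (1 / 2 - ε) * (3 * q + 1 : ℝ) ≤ B.card ∧ (B.card : ℝ) ≤ (1 / 2 + ε) * (3 * q + 1 : ℝ) ∧
        2 * (bobPart P B).card ≤ 3 * q + 1).card : ℝ)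
      ≤ (2 : ℝ) ^ (-(C * (3 * q + 1 : ℝ))) * (normalCount q t : ℝ)

/-! ## 3. Card `seam-scc-cayley` -/

section twosat

variable {V : Type*}

/-- `U` is an up-set of the arc relation `r`. -/
def IsUpset (r : V → V → Prop) (U : Set V) : Prop := ∀ x y, r x y → x ∈ U → y ∈ U

theorem reflTransGen_mem_upset {r : V → V → Prop} {U : Set V} (hU : IsUpset r U) {x y : V}
    (hxy : Relation.ReflTransGen r x y) (hx : x ∈ U) : y ∈ U := by
  induction hxy with
  | refl => exact hx
  | tail _ hbc ih => exact hU _ _ hbc ih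

/-- ABSTRACT CORE of the seam-SCC criterion.  An implication system (arcs `r`, clauses
`f x → f y`) plus ONE xor clause `f x ≠ f y` is satisfiable iff `x` and `y` are NOT mutually
reachable, i.e. do not lie in one strongly connected component. -/
theorem upset_separates_iff_not_biReachable (r : V → V → Prop) (x y : V) :
    (∃ U : Set V, IsUpset r U ∧ ((x ∈ U ∧ y ∉ U) ∨ (y ∈ U ∧ x ∉ U))) ↔
      ¬ (Relation.ReflTransGen r x y ∧ Relation.ReflTransGen r y x) := by
  constructor
  · rintro ⟨U, hU, h⟩ ⟨hxy, hyx⟩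
    rcases h with ⟨hx, hy⟩ | ⟨hy, hx⟩
    · exact hy (reflTransGen_mem_upset hU hxy hx)
    · exact hx (reflTransGen_mem_upset hU hyx hy)
  · intro h
    by_cases hxy : Relation.ReflTransGen r x y
    · have hyx : ¬ Relation.ReflTransGen r y x := fun hyx => h ⟨hxy, hyx⟩
      refine ⟨{z | Relation.ReflTransGen r y z}, ?_, Or.inr ⟨?_, ?_⟩⟩
      · intro a b hab ha; exact Relation.ReflTransGen.tail ha hab
      · exact Relation.ReflTransGen.refl
      · exact hyx
    · refine ⟨{z | Relation.ReflTransGen r x z}, ?_, Or.inl ⟨?_, ?_⟩⟩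
      · intro a b hab ha; exact Relation.ReflTransGen.tail ha hab
      · exact Relation.ReflTransGen.refl
      · exact hxy

end twosat

/-- residue of vertex `v` in frame `k` of the system `P`. -/
def res (P : Rulers q t) (k : Fin t) (v : Fin (3 * q + 1)) : ℕ := (P k v).val % 3

/-- the FRAME-`k` ARC RELATION of an edge set `H` read with the residues of `P`:
an edge `{x, y}` with `res y ≡ res x + 1` is the implication `f x → f y`. -/
def frameArc (P : Rulers q t) (k : Fin t) (H : Finset (Sym2 (Fin (3 * q + 1))))
    (x y : Fin (3 * q + 1)) : Prop :=
  s(x, y) ∈ H ∧ res P k y = (res P k x + 1) % 3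

/-- a frame-`k` shift colouring: `c v = res v + f v (mod 3)` with `f : V → Bool`. -/
def shiftColour (P : Rulers q t) (k : Fin t) (f : Fin (3 * q + 1) → Bool) (v : Fin (3 * q + 1)) : ℕ :=
  (res P k v + (if f v then 1 else 0)) % 3

/-- FRAME UP-SET CRITERION (typed; the clause table `res y = res x + 1 ⇒ (f x, f y) ≠ (1,0)`,
`res x = res y ⇒ f x ≠ f y`): a proper frame-`k` shift colouring of `H` exists iff some up-set of
`frameArc P k H` splits every equal-residue edge of `H`.  With `upset_separates_iff_not_biReachable`
this is the seam-SCC criterion when `H` has exactly one equal-residue edge (the `k`-seam). -/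
def FrameUpsetCriterion (q t : ℕ) : Prop :=
  ∀ (P : Rulers q t) (k : Fin t) (H : Finset (Sym2 (Fin (3 * q + 1)))), (∀ e ∈ H, ¬ e.IsDiag) →
    ((∃ f : Fin (3 * q + 1) → Bool, ∀ x y, s(x, y) ∈ H → shiftColour P k f x ≠ shiftColour P k f y) ↔
      ∃ U : Set (Fin (3 * q + 1)), IsUpset (frameArc P k H) U ∧
        ∀ x y, s(x, y) ∈ H → res P k x = res P k y → ((x ∈ U ∧ y ∉ U) ∨ (y ∈ U ∧ x ∉ U)))


/-- The frame up-set criterion HOLDS (clause table, proved): frame-`k` shift colourings of `H` are exactly the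
up-sets of `frameArc P k H` that split every equal-residue edge. -/
theorem frameUpsetCriterion_holds (q t : ℕ) : FrameUpsetCriterion q t := by
  intro P k H _hH
  constructor
  · rintro ⟨f, hf⟩
    refine ⟨{v | f v = true}, ?_, ?_⟩
    · rintro x y ⟨hxy, hres⟩ hx
      simp only [Set.mem_setOf_eq] at hx ⊢
      by_contra hy
      have hy' : f y = false := by simpa using hy
      have hne := hf x y hxy
      have h3 : res P k y < 3 := Nat.mod_lt _ (by norm_num)
      apply hne
      unfold shiftColour
      rw [hx, hy']
      simp only [ite_true, Bool.false_eq_true, ite_false, add_zero]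
      omega
    · intro x y hxy hres
      have hne := hf x y hxy
      have h3 : res P k y < 3 := Nat.mod_lt _ (by norm_num)
      unfold shiftColour at hne
      simp only [Set.mem_setOf_eq]
      cases hfx : f x <;> cases hfy : f y <;> simp_all
  · rintro ⟨U, hU, hsplit⟩
    classical
    refine ⟨fun v => decide (v ∈ U), ?_⟩
    intro x y hxy
    have hx3 : res P k x < 3 := Nat.mod_lt _ (by norm_num)
    have hy3 : res P k y < 3 := Nat.mod_lt _ (by norm_num)
    unfold shiftColour
    by_cases hxU : x ∈ U <;> by_cases hyU : y ∈ U <;>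
      simp only [hxU, hyU, decide_true, decide_false, ite_true, ite_false, Bool.false_eq_true, add_zero] <;>
      intro heq
    · have hres : res P k x = res P k y := by omega
      rcases hsplit x y hxy hres with ⟨_, h⟩ | ⟨_, h⟩ <;> contradiction
    · have hres : res P k y = (res P k x + 1) % 3 := by omega
      exact hyU (hU x y ⟨hxy, hres⟩ hxU)
    · have hres : res P k x = (res P k y + 1) % 3 := by omega
      have hyx : s(y, x) ∈ H := by rw [Sym2.eq_swap]; exact hxy
      exact hxU (hU y x ⟨hyx, hres⟩ hyU)
    · have hres : res P k x = res P k y := by omega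
      rcases hsplit x y hxy hres with ⟨h, _⟩ | ⟨h, _⟩ <;> contradiction

/-- BLOCKED: Alice's part of `P` and Bob's part of `P'` at `B` form a non-3-colourable hybrid
(`P'`'s Bob side captures `P`'s Alice side). -/
def Blocked (P P' : Rulers q t) (B : Finset (Fin (3 * q + 1))) : Prop :=
  ¬ (SimpleGraph.fromEdgeSet ((alicePart P B ∪ bobPart P' B : Finset _) :
      Set (Sym2 (Fin (3 * q + 1))))).Colorable 3

/-- relabelling a system by a vertex permutation `ψ`: vertex `ψ v` gets the positions of `v`. -/
def relabel (ψ : Equiv.Perm (Fin (3 * q + 1))) (P : Rulers q t) : Rulers q t :=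
  fun k => ψ.symm.trans (P k)

/-- `ψ` preserves every residue class of `P` (it permutes each joint residue cell). -/
def CellPreserving (P : Rulers q t) (ψ : Equiv.Perm (Fin (3 * q + 1))) : Prop :=
  ∀ k v, res P k (ψ v) = res P k v

/-- `B` is a union of joint residue cells of `P`. -/
def CellUnion (P : Rulers q t) (B : Finset (Fin (3 * q + 1))) : Prop :=
  ∀ v w, (∀ k, res P k v = res P k w) → (v ∈ B ↔ w ∈ B)

/-- CAYLEY INVARIANCE (typed, provable by transporting colourings along `ψ₁`): at a cell-union cut
the blocking relation between two cell-preserving relabellings of one system depends only on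
`ψ₁⁻¹ ψ₂` — the aligned blocking matrix on a `G_cells`-orbit is a Cayley (group-circulant) matrix of
`G_cells = ∏_cells Sym(cell)`. -/
def BlockedCayley (q t : ℕ) : Prop :=
  ∀ (P : Rulers q t) (B : Finset (Fin (3 * q + 1))) (ψ₁ ψ₂ : Equiv.Perm (Fin (3 * q + 1))),
    CellPreserving P ψ₁ → CellPreserving P ψ₂ → CellUnion P B →
      (Blocked (relabel ψ₁ P) (relabel ψ₂ P) B ↔ Blocked P (relabel (ψ₁⁻¹ * ψ₂) P) B)


/-! ### Proof of `BlockedCayley` (transport of structure along `ψ₁`) -/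

section cayley

theorem succ_relabel (ψ : Equiv.Perm (Fin (3 * q + 1))) (P : Rulers q t) (k : Fin t) (v : Fin (3 * q + 1)) :
    succ (relabel ψ P) k v = ψ (succ P k (ψ.symm v)) := by
  unfold succ relabel
  simp [Equiv.trans_apply]

theorem edges_relabel (ψ : Equiv.Perm (Fin (3 * q + 1))) (P : Rulers q t) :
    edges (relabel ψ P) = (edges P).image (Sym2.map ψ) := by
  ext e
  simp only [edges, Finset.mem_biUnion, Finset.mem_univ, true_and, Finset.mem_image]
  constructor
  · rintro ⟨k, v, rfl⟩
    refine ⟨s(ψ.symm v, succ P k (ψ.symm v)), ⟨k, ψ.symm v, rfl⟩, ?_⟩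
    rw [Sym2.map_mk, succ_relabel, Equiv.apply_symm_apply]
  · rintro ⟨e', ⟨k, w, rfl⟩, rfl⟩
    refine ⟨k, ψ w, ?_⟩
    rw [Sym2.map_mk, succ_relabel, Equiv.symm_apply_apply]

theorem mem_cut_iff_of_cell {P : Rulers q t} {ψ : Equiv.Perm (Fin (3 * q + 1))} {B : Finset (Fin (3 * q + 1))}
    (hψ : CellPreserving P ψ) (hB : CellUnion P B) (v : Fin (3 * q + 1)) : ψ v ∈ B ↔ v ∈ B :=
  hB (ψ v) v (fun k => hψ k v)

theorem bobPart_relabel {P : Rulers q t} {ψ : Equiv.Perm (Fin (3 * q + 1))} {B : Finset (Fin (3 * q + 1))}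
    (hψ : CellPreserving P ψ) (hB : CellUnion P B) :
    bobPart (relabel ψ P) B = (bobPart P B).image (Sym2.map ψ) := by
  unfold bobPart
  rw [edges_relabel, Finset.filter_image]
  congr 1
  apply Finset.filter_congr
  intro e _
  constructor
  · intro h v hv
    have := h (ψ v) (Sym2.mem_map.mpr ⟨v, hv, rfl⟩)
    rwa [mem_cut_iff_of_cell hψ hB] at this
  · intro h v hv
    obtain ⟨w, hw, rfl⟩ := Sym2.mem_map.mp hv
    rw [mem_cut_iff_of_cell hψ hB]
    exact h w hw

theorem alicePart_relabel {P : Rulers q t} {ψ : Equiv.Perm (Fin (3 * q + 1))} {B : Finset (Fin (3 * q + 1))}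
    (hψ : CellPreserving P ψ) (hB : CellUnion P B) :
    alicePart (relabel ψ P) B = (alicePart P B).image (Sym2.map ψ) := by
  unfold alicePart
  rw [edges_relabel, Finset.filter_image]
  congr 1
  apply Finset.filter_congr
  intro e _
  constructor
  · rintro ⟨v, hv, hvB⟩
    obtain ⟨w, hw, rfl⟩ := Sym2.mem_map.mp hv
    exact ⟨w, hw, fun hwB => hvB ((mem_cut_iff_of_cell hψ hB w).mpr hwB)⟩
  · rintro ⟨w, hw, hwB⟩
    exact ⟨ψ w, Sym2.mem_map.mpr ⟨w, hw, rfl⟩, fun h => hwB ((mem_cut_iff_of_cell hψ hB w).mp h)⟩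

/-- 3-colourability of an edge set is invariant under relabelling the vertices by a permutation. -/
theorem colorable_image_iff {n : ℕ} (ψ : Equiv.Perm (Fin n)) (S : Finset (Sym2 (Fin n))) (m : ℕ) :
    (SimpleGraph.fromEdgeSet ((S.image (Sym2.map ψ) : Finset (Sym2 (Fin n))) : Set (Sym2 (Fin n)))).Colorable m ↔
      (SimpleGraph.fromEdgeSet (S : Set (Sym2 (Fin n)))).Colorable m := by
  constructor
  · rintro ⟨C⟩
    refine ⟨C.comp ⟨ψ, ?_⟩⟩
    intro a b hab
    rw [SimpleGraph.fromEdgeSet_adj] at hab ⊢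
    refine ⟨?_, ψ.injective.ne hab.2⟩
    rw [Finset.mem_coe, Finset.mem_image]
    exact ⟨s(a, b), hab.1, Sym2.map_mk ψ a b⟩
  · rintro ⟨C⟩
    refine ⟨C.comp ⟨ψ.symm, ?_⟩⟩
    intro a b hab
    rw [SimpleGraph.fromEdgeSet_adj] at hab ⊢
    refine ⟨?_, ψ.symm.injective.ne hab.2⟩
    have h1 := hab.1
    rw [Finset.mem_coe, Finset.mem_image] at h1
    obtain ⟨e, he, hee⟩ := h1
    have hid : Sym2.map (ψ.symm ∘ ψ) e = e := by
      have : (ψ.symm ∘ ψ : Fin n → Fin n) = id := by funext x; simp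
      rw [this, Sym2.map_id]; rfl
    have : e = s(ψ.symm a, ψ.symm b) := by
      have h2 := congrArg (Sym2.map ψ.symm) hee
      rw [Sym2.map_map, Sym2.map_mk, hid] at h2
      exact h2
    rw [Finset.mem_coe, ← this]
    exact he

/-- CAYLEY INVARIANCE HOLDS. -/
theorem blockedCayley_holds (q t : ℕ) : BlockedCayley q t := by
  intro P B ψ₁ ψ₂ h₁ h₂ hB
  have h12 : CellPreserving P (ψ₁⁻¹ * ψ₂) := by
    intro k v
    show res P k (ψ₁.symm (ψ₂ v)) = res P k v
    have a := h₁ k (ψ₁.symm (ψ₂ v))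
    rw [Equiv.apply_symm_apply] at a
    rw [← a, h₂ k v]
  unfold Blocked
  rw [alicePart_relabel h₁ hB, bobPart_relabel h₂ hB, bobPart_relabel h12 hB]
  have key : (alicePart P B).image (Sym2.map ψ₁) ∪ (bobPart P B).image (Sym2.map ψ₂)
      = (alicePart P B ∪ (bobPart P B).image (Sym2.map ⇑(ψ₁⁻¹ * ψ₂))).image (Sym2.map ψ₁) := by
    rw [Finset.image_union, Finset.image_image]
    congr 2
    funext e
    simp only [Function.comp_apply, Sym2.map_map]
    congr 1
    funext x
    simp [Equiv.Perm.coe_mul]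
  rw [key, colorable_image_iff]

end cayley

open Classical in
/-- CELL-CAYLEY CLIQUE BOUND at strength `g` (the RS-type target): inside one `G_cells`-orbit of a
rigid normal system, at an `ε`-balanced cell-union cut, a set `F` of relabellings that is a capture
clique (`Blocked` in both directions for all distinct pairs) has density `≤ 2^{-g(n)}` in the orbit.
Raz–Spieker strength: `g n = c·n·log(log n)`; fibre strength (what X1 needs): `g n = (1/2+ε)·n·log₂ n - C n`. -/
def CellCayleyCliqueBound (t : ℕ) (ε : ℝ) (g : ℕ → ℝ) : Prop :=
  ∃ q₀ : ℕ, ∀ q ≥ q₀, ∀ (P : Rulers q t), IsNormal P → Rigid P →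
    ∀ (B : Finset (Fin (3 * q + 1))), CellUnion P B →
      (1 / 2 - ε) * (3 * q + 1 : ℝ) ≤ B.card → (B.card : ℝ) ≤ (1 / 2 + ε) * (3 * q + 1 : ℝ) →
      ∀ F : Finset (Equiv.Perm (Fin (3 * q + 1))),
        (∀ ψ ∈ F, CellPreserving P ψ) →
        (∀ ψ ∈ F, ∀ ψ' ∈ F, ψ ≠ ψ' → Blocked (relabel ψ P) (relabel ψ' P) B) →
        (F.card : ℝ) ≤ (2 : ℝ) ^ (-(g (3 * q + 1))) *
          ((univ.filter fun ψ : Equiv.Perm (Fin (3 * q + 1)) => CellPreserving P ψ).card : ℝ)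

end Summit.PneNP.PneNP.Cruxes.FoolingMeasure.IdeasR2g8
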